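import Summits.NavierStokesRegularity.NavierStokesRegularity.Theorems.ScenarioCensusFloquetMeter
import Summits.NavierStokesRegularity.NavierStokesRegularity.Theorems.ScenarioCensusModeRankShell
import HarnessLib

/-!
# LINE «floquet-meter» port, part 2/3: `Row_A1fm` (one Floquet multiplier of the time-`τ` map), `floquet_contractive` / `floquet_expansive`, `row_A1fm_holds` (§E)

Re-homed for the scenario census (typer seat ns-census-typer-1 g8; the cells A1fm / A1e1 / A1cx0 are MEMBERS OF RECORD «DECIDED IN KERNEL IN FILES» of row A1apT
since census v1.72 (critic idea-crit-3 g7 PASS 23:21:11Z; ref ns-census-ref g9 PRE-CHECK ✓ §14.18 item 30; lead-presearch label), A1cx since v1.71 (temporal-spectrum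
REV 4; restated VERBATIM here and decided by nesting); this port makes them TREE-decided): VERBATIM PORT of ns-idea-2 LINE g13-1 «floquet-meter» REV 1,
`pub/ideators/ns-idea-2/lines/floquet-meter/line-floquet-meter.lean` sha16 add9e8af7413777b (750 l., lean check rc 0, 0 sorry), split for the 400-line rule into
`ScenarioCensusFloquetMeter` (§A–§D) → `…FloquetMeterRow` (§E) → `…FloquetMeterCells` (§F–§G + census KEYS).  Lean text VERBATIM in namespace
`…Theorems.ScenarioCensus.FloquetMeter` (the line's `…Lines.FloquetMeter` re-homed); port edits: `local notation "E3"` → `abbrev E3` (typer lint: no notation in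
port files), `@[conjecture]` on the OPEN head `Row_A1fr` and next cell `Row_A1fs` (typed only), seven one-line docstrings added (gate lint); the one deprecated lemma name at the kit's l.503
(`ContinuousLinearMap.coe_smul'` → `FunLike.coe_smul`, the replacement the linter names — exactly the line's REV 2 file bb1b268c071fb3ef, its only difference) is
used (proof text only); the §A lemmas the line
shares verbatim with «mode-rank» are taken BY NAME from the landed mode-rank port (listed below), `tendsto_typeI_bound` is not re-declared (used only there) and
the coordinate bound `abs_apply_le_norm'` (twin of landed Literature lemmas) is replaced at its one use by Mathlib's `PiLp.norm_apply_le` (proof text only).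
Statements untouched.

No census VALUE is moved here (row A1apT keeps its value; the members become TREE-decided by name); NS regularity is NOT proved; (L′) ⟨10661⟩ is
untouched; no summit statement is proved by this file. Lemmas that restate already-landed tree declarations are taken BY NAME (gate lint `dedup.landed`): `apply_eq_apply_of_harmonic_bounded` = `ModeRank.apply_eq_apply_of_harmonic_bounded`, `apply_eq_apply_of_curl_const` = `ModeRank.apply_eq_apply_of_curl_const`, `tendsto_slice_atBot` = `ModeRank.tendsto_slice_atBot`, `eq_zero_of_curl_slice_const` = `ModeRank.eq_zero_of_curl_slice_const`.
-/

-- the summit and its single problem share the name `NavierStokesRegularity` (D-0017 nested layout)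
set_option linter.dupNamespace false

noncomputable section

open Set Function Filter Topology

namespace Summit.NavierStokesRegularity.NavierStokesRegularity.Theorems.ScenarioCensus.FloquetMeter

open Literature.Analysis Literature.Analysis.FluidPDE InnerProductSpace
open Summit.NavierStokesRegularity.NavierStokesRegularity.Theorems (vorticity_eq_deriv_of_typeI)
open scoped Laplacian InnerProductSpace RealInnerProductSpace ContDiff

/-! ## E. Row A1fm — ONE FLOQUET MULTIPLIER (the amplitude character of the time-`τ` map) -/

/-- **Row A1fm (one Floquet multiplier)** — census A-block cell, (L′)-shape over the genuine class
`IsTypeIAncientMild C u` BY NAME: if for some period `τ > 0` and some real multiplier `μ` the field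
reproduces itself up to amplitude after time `τ`, `u(t + τ, ·) = μ · u(t, ·)` whenever `t + τ < 0`, then
`u ≡ 0` on `t < 0`.  No hypothesis on the spatial structure of the slices, none on the sign or size of
`μ` (`μ = 1`: time-periodic; `μ = -1`: anti-periodic; `|μ| < 1`: decaying; `|μ| > 1`: GROWING INTO THE
SINGULAR TIME with arbitrary `τ`-periodic fine structure `u = e^{at} P(t, x)`, `a = log|μ|/τ`,
`P(t + τ) = ± P(t)`). -/
def Row_A1fm : Prop :=
  ∀ (C : ℝ) (u : ℝ → E3 → E3), IsTypeIAncientMild C u →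
    ∀ (τ μ : ℝ), 0 < τ → (∀ t : ℝ, t + τ < 0 → ∀ x, u (t + τ) x = μ • u t x) →
      ∀ t < 0, ∀ x, u t x = 0

/-- The contractive case `|μ| ≤ 1`: Type-I decay along the backward orbit `t - nτ`
(`u(t) = μⁿ u(t - nτ)`, `‖u(t - nτ, x)‖ ≤ C/√(nτ - t) → 0`). -/
theorem floquet_contractive {C : ℝ} {u : ℝ → E3 → E3} (hu : IsTypeIAncientMild C u) {τ μ : ℝ}
    (hτ : 0 < τ) (hfl : ∀ t : ℝ, t + τ < 0 → ∀ x, u (t + τ) x = μ • u t x) (hμ : |μ| ≤ 1) :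
    ∀ t < 0, ∀ x, u t x = 0 := by
  intro t ht x
  have hrep : ∀ n : ℕ, u t x = μ ^ n • u (t - n * τ) x := by
    intro n
    have h := floquet_iter (V := u) hτ.le hfl n (t - n * τ) (by rw [sub_add_cancel]; exact ht) x
    rw [sub_add_cancel] at h
    exact h
  have hle : ∀ n : ℕ, ‖u t x‖ ≤ ‖u (t - n * τ) x‖ := by
    intro n
    rw [hrep n, norm_smul, norm_pow, Real.norm_eq_abs]
    exact mul_le_of_le_one_left (norm_nonneg _) (pow_le_one₀ (abs_nonneg μ) hμ)
  have h0 : Tendsto (fun n : ℕ => (n : ℝ) * τ) atTop atTop :=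
    tendsto_natCast_atTop_atTop.atTop_mul_const hτ
  have h1 : Tendsto (fun n : ℕ => t + -((n : ℝ) * τ)) atTop atBot :=
    tendsto_atBot_add_const_left _ t (tendsto_neg_atTop_atBot.comp h0)
  have hlim : Tendsto (fun n : ℕ => ‖u (t - n * τ) x‖) atTop (𝓝 0) := by
    have h2 := ((ModeRank.tendsto_slice_atBot hu x).comp h1).norm
    rw [norm_zero] at h2
    refine h2.congr fun n => ?_
    simp [sub_eq_add_neg]
  have h3 : ‖u t x‖ ≤ 0 := ge_of_tendsto' hlim hle
  exact norm_le_zero_iff.1 h3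

/-- The expansive case `|μ| > 1`.  (1) The vorticity inherits the multiplier: `ω(t+τ) = μ ω(t)`.
(2) AMPLITUDE INHOMOGENEITY: the vorticity identity `∂ₜω + (u·∇)ω = (ω·∇)u + Δω`
(`vorticity_eq_deriv_of_typeI`) at `t` and at `t + τ` reads `∂ₜω = N + Δω` and `μ ∂ₜω = μ² N + μ Δω`
with the same `N = (ω·∇)u - (u·∇)ω`, so `(μ² - μ)(Δω - ∂ₜω) = 0`: for `μ ∉ {0, 1}` the vorticity solves
the HEAT EQUATION `∂ₜω = Δω` pointwise on `t < -τ`.  (3) `f = e^{-2at}|ω|²`, `a = log|μ|/τ > 0`, is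
`τ`-PERIODIC (`e^{2aτ} = μ²`), bounded on a window (the class's vorticity bound,
`typeI_exists_curl_bound_window`) and a subsolution `∂ₜf + 2a f = 2e^{-2at}⟪ω, Δω⟫ ≤ Δf`
(`laplacian_inner_self_eq`), so `f ≤ 0` on the window by the periodic parabolic barrier; (4) the Floquet
relation transports `ω = 0` to every `t < 0` (`exists_window_repr`, `floquet_iter`), and (5) the KNSS
gauge (`ModeRank.eq_zero_of_curl_slice_const`) gives `u ≡ 0`. -/
theorem floquet_expansive {C : ℝ} {u : ℝ → E3 → E3} (hu : IsTypeIAncientMild C u) {τ μ : ℝ}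
    (hτ : 0 < τ) (hfl : ∀ t : ℝ, t + τ < 0 → ∀ x, u (t + τ) x = μ • u t x) (hμ : 1 < |μ|) :
    ∀ t < 0, ∀ x, u t x = 0 := by
  have hμpos : 0 < |μ| := by linarith
  have hμ0 : μ ≠ 0 := abs_pos.1 hμpos
  have hμ1 : μ ≠ 1 := fun h => by rw [h, abs_one] at hμ; exact lt_irrefl _ hμ
  -- regularity from the class
  have hsm : IsSmoothSpaceTimeOn (Iio 0) u := hu.contDiffOn
  have hω : IsSmoothSpaceTimeOn (Iio 0) (fun s y => curl (u s) y) :=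
    curlCLM.contDiff.comp_contDiffOn (hsm.isSmoothSpaceTimeOn_fderiv_of_isOpen isOpen_Iio)
  have hu2 : ∀ s < 0, ContDiff ℝ 2 (u s) := fun s hs => (hu.contDiff_slice hs).of_le (by norm_cast)
  have hu3 : ∀ s < 0, ContDiff ℝ 3 (u s) := fun s hs => (hu.contDiff_slice hs).of_le (by norm_cast)
  have hω2 : ∀ s < 0, ContDiff ℝ 2 (curl (u s)) := fun s hs => contDiff_curl (hu3 s hs)
  have hud : ∀ s < 0, ∀ y, DifferentiableAt ℝ (u s) y := fun s hs y =>
    ((hu2 s hs).differentiable (by norm_num)).differentiableAt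
  have hωd : ∀ s < 0, ∀ y, DifferentiableAt ℝ (curl (u s)) y := fun s hs y =>
    ((hω2 s hs).differentiable (by norm_num)).differentiableAt
  have hline : ∀ s < 0, ∀ y,
      HasDerivAt (fun r => curl (u r) y) (deriv (fun r => curl (u r) y) s) s :=
    fun s hs y => hω.hasDerivAt_timeLine isOpen_Iio hs y
  -- (1) the Floquet relation for the vorticity
  have hflω : ∀ t : ℝ, t + τ < 0 → ∀ x, curl (u (t + τ)) x = μ • curl (u t) x := by
    intro t ht x
    have ht' : t < 0 := by linarith
    have hfun : u (t + τ) = fun y => μ • u t y := funext (hfl t ht)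
    rw [hfun, curl_const_smul (hud t ht' x)]
  -- (2) amplitude inhomogeneity ⇒ the heat equation for the vorticity on `t < -τ`
  have hheat : ∀ t : ℝ, t + τ < 0 → ∀ x,
      deriv (fun s => curl (u s) x) t = (Δ (curl (u t))) x := by
    intro t ht x
    have ht' : t < 0 := by linarith
    have e1 := vorticity_eq_deriv_of_typeI hu ht' x
    have e2 := vorticity_eq_deriv_of_typeI hu ht x
    have hfunu : u (t + τ) = fun y => μ • u t y := funext (hfl t ht)
    have hfunω : curl (u (t + τ)) = fun y => μ • curl (u t) y := funext (hflω t ht)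
    have hder : deriv (fun s => curl (u s) x) (t + τ) = μ • deriv (fun s => curl (u s) x) t := by
      rw [← deriv_comp_add_const (fun s => curl (u s) x) τ t]
      have hev : (fun s => curl (u (s + τ)) x) =ᶠ[𝓝 t] fun s => μ • curl (u s) x := by
        have hmem : Iio (-τ) ∈ 𝓝 t := isOpen_Iio.mem_nhds (by rw [mem_Iio]; linarith)
        filter_upwards [hmem] with s hs
        rw [mem_Iio] at hs
        exact hflω s (by linarith) x
      rw [hev.deriv_eq]
      exact ((hline t ht' x).const_smul μ).deriv
    have hΔ : (Δ (fun y => μ • curl (u t) y)) x = μ • (Δ (curl (u t))) x := by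
      have e : (fun y => μ • curl (u t) y) = μ • curl (u t) := rfl
      rw [e, InnerProductSpace.laplacian_smul μ (hω2 t ht').contDiffAt]
    rw [hder, hfunω, hfunu, fderiv_fun_const_smul (hωd t ht' x), fderiv_fun_const_smul (hud t ht' x),
      hΔ] at e2
    simp only [FunLike.coe_smul, Pi.smul_apply, map_smul, smul_smul] at e2
    -- e1 : D + P = Q + L,  e2 : μ • D + (μ * μ) • P = (μ * μ) • Q + μ • L
    have e1' : fderiv ℝ (curl (u t)) x (u t x)
        = fderiv ℝ (u t) x (curl (u t) x) + (Δ (curl (u t))) x - deriv (fun s => curl (u s) x) t :=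
      eq_sub_of_add_eq' e1
    rw [e1'] at e2
    have h4 : (μ * μ - μ) • ((Δ (curl (u t))) x - deriv (fun s => curl (u s) x) t) = 0 := by
      have h5 := sub_eq_zero.2 e2
      rw [← h5]
      module
    have hμμ : μ * μ - μ ≠ 0 := by
      rw [show μ * μ - μ = μ * (μ - 1) by ring]
      exact mul_ne_zero hμ0 (sub_ne_zero.2 hμ1)
    rcases smul_eq_zero.1 h4 with h | h
    · exact absurd h hμμ
    · exact (sub_eq_zero.1 h).symm
  -- (3) the growth rate and the barrier function
  set a : ℝ := Real.log |μ| / τ with hadef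
  have hlog : 0 < Real.log |μ| := Real.log_pos hμ
  have ha0 : 0 < a := div_pos hlog hτ
  have hexp : Real.exp (a * τ) = |μ| := by
    rw [hadef, div_mul_cancel₀ _ hτ.ne', Real.exp_log hμpos]
  have hkey : Real.exp (-(2 * a) * τ) * (μ * μ) = 1 := by
    rw [show -(2 * a) * τ = -(a * τ) + -(a * τ) by ring, Real.exp_add, Real.exp_neg, hexp,
      ← abs_mul_abs_self μ]
    field_simp
  set f : ℝ → E3 → ℝ := fun s y => Real.exp (-(2 * a) * s) * ⟪curl (u s) y, curl (u s) y⟫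
    with hfdef
  -- the window `[-3τ, -τ]`
  have hW0 : ∀ t ∈ Icc (-3 * τ) (-3 * τ + 2 * τ), t < 0 := fun t ht => by linarith [ht.2]
  have hcont : ContinuousOn (uncurry f) (Icc (-3 * τ) (-3 * τ + 2 * τ) ×ˢ univ) := by
    have hsub : Icc (-3 * τ) (-3 * τ + 2 * τ) ×ˢ (univ : Set E3) ⊆ Iio 0 ×ˢ univ :=
      prod_mono (fun t ht => hW0 t ht) Subset.rfl
    have hωc : ContinuousOn (fun p : ℝ × E3 => curl (u p.1) p.2)
        (Icc (-3 * τ) (-3 * τ + 2 * τ) ×ˢ univ) := hω.continuousOn.mono hsub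
    have hec : ContinuousOn (fun p : ℝ × E3 => Real.exp (-(2 * a) * p.1))
        (Icc (-3 * τ) (-3 * τ + 2 * τ) ×ˢ univ) :=
      (Real.continuous_exp.comp (continuous_const.mul continuous_fst)).continuousOn
    exact hec.mul (hωc.inner hωc)
  have hC2 : ∀ t ∈ Icc (-3 * τ) (-3 * τ + 2 * τ), ContDiff ℝ 2 (f t) := by
    intro t ht
    exact contDiff_const.mul ((hω2 t (hW0 t ht)).inner ℝ (hω2 t (hW0 t ht)))
  have hper : ∀ t ∈ Icc (-3 * τ) (-3 * τ + τ), ∀ x, f (t + τ) x = f t x := by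
    intro t ht x
    have h : t + τ < 0 := by linarith [ht.2]
    show Real.exp (-(2 * a) * (t + τ)) * ⟪curl (u (t + τ)) x, curl (u (t + τ)) x⟫
      = Real.exp (-(2 * a) * t) * ⟪curl (u t) x, curl (u t) x⟫
    rw [hflω t h, real_inner_smul_left, real_inner_smul_right,
      show -(2 * a) * (t + τ) = -(2 * a) * t + -(2 * a) * τ by ring, Real.exp_add]
    calc Real.exp (-(2 * a) * t) * Real.exp (-(2 * a) * τ)
          * (μ * (μ * ⟪curl (u t) x, curl (u t) x⟫))
        = Real.exp (-(2 * a) * t) * (Real.exp (-(2 * a) * τ) * (μ * μ))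
          * ⟪curl (u t) x, curl (u t) x⟫ := by ring
      _ = Real.exp (-(2 * a) * t) * ⟪curl (u t) x, curl (u t) x⟫ := by rw [hkey, mul_one]
  obtain ⟨Aω, hAω⟩ := typeI_exists_curl_bound_window hu (B₁ := -3 * τ) (B₂ := -3 * τ + 2 * τ)
    (by linarith) (by linarith)
  have hbd : ∀ t ∈ Icc (-3 * τ) (-3 * τ + 2 * τ), ∀ x, f t x ≤ Real.exp (6 * a * τ) * Aω ^ 2 := by
    intro t ht x
    show Real.exp (-(2 * a) * t) * ⟪curl (u t) x, curl (u t) x⟫ ≤ Real.exp (6 * a * τ) * Aω ^ 2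
    rw [real_inner_self_eq_norm_sq]
    have h1 : Real.exp (-(2 * a) * t) ≤ Real.exp (6 * a * τ) :=
      Real.exp_le_exp.2 (by nlinarith [ht.1])
    have h2 : ‖curl (u t) x‖ ^ 2 ≤ Aω ^ 2 := pow_le_pow_left₀ (norm_nonneg _) (hAω t ht x) 2
    exact mul_le_mul h1 h2 (by positivity) (by positivity)
  have hsub : ∀ t ∈ Ioo (-3 * τ) (-3 * τ + 2 * τ), ∀ x,
      deriv (fun s => f s x) t + (2 * a) * f t x ≤ (Δ (f t)) x := by
    intro t ht x
    have htτ : t + τ < 0 := by linarith [ht.2]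
    have ht' : t < 0 := by linarith
    have hD := hheat t htτ x
    -- time derivative
    have he : HasDerivAt (fun s => Real.exp (-(2 * a) * s))
        (Real.exp (-(2 * a) * t) * (-(2 * a))) t := by
      have := ((hasDerivAt_id t).const_mul (-(2 * a))).exp
      simpa using this
    have hin := (hline t ht' x).inner ℝ (hline t ht' x)
    have hprod := he.mul hin
    have hderiv : deriv (fun s => f s x) t
        = Real.exp (-(2 * a) * t) * (-(2 * a)) * ⟪curl (u t) x, curl (u t) x⟫
          + Real.exp (-(2 * a) * t) * (⟪curl (u t) x, (Δ (curl (u t))) x⟫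
            + ⟪(Δ (curl (u t))) x, curl (u t) x⟫) := by
      rw [← hD]
      exact hprod.deriv
    -- Laplacian of the slice
    have hin2 : ContDiff ℝ 2 (fun y => ⟪curl (u t) y, curl (u t) y⟫) :=
      (hω2 t ht').inner ℝ (hω2 t ht')
    have hft : f t = Real.exp (-(2 * a) * t) • fun y => ⟪curl (u t) y, curl (u t) y⟫ := by
      funext y; simp [hfdef]
    have hlap : (Δ (f t)) x = Real.exp (-(2 * a) * t)
        * (2 * ⟪(Δ (curl (u t))) x, curl (u t) x⟫ + 2 * frobeniusNormSq (fderiv ℝ (curl (u t)) x)) := by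
      rw [hft, InnerProductSpace.laplacian_smul _ hin2.contDiffAt, laplacian_inner_self_eq (hω2 t ht'),
        smul_eq_mul]
    have hfx : f t x = Real.exp (-(2 * a) * t) * ⟪curl (u t) x, curl (u t) x⟫ := rfl
    have hcomm : ⟪curl (u t) x, (Δ (curl (u t))) x⟫ = ⟪(Δ (curl (u t))) x, curl (u t) x⟫ :=
      real_inner_comm _ _
    rw [hderiv, hlap, hfx, hcomm]
    nlinarith [frobeniusNormSq_nonneg (fderiv ℝ (curl (u t)) x), Real.exp_pos (-(2 * a) * t)]
  -- (4) the periodic parabolic barrier on the window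
  have hppb := periodic_parabolic_barrier (A := -3 * τ) (M := Real.exp (6 * a * τ) * Aω ^ 2) hτ
    (by positivity : 0 < 2 * a) hcont hC2 hper hbd hsub
  have hωW : ∀ t ∈ Icc (-3 * τ) (-3 * τ + 2 * τ), ∀ x, curl (u t) x = 0 := by
    intro t ht x
    have h1 : Real.exp (-(2 * a) * t) * ⟪curl (u t) x, curl (u t) x⟫ ≤ 0 := hppb t ht x
    have h2 : ⟪curl (u t) x, curl (u t) x⟫ ≤ 0 := by
      by_contra h3
      push Not at h3
      have := mul_pos (Real.exp_pos (-(2 * a) * t)) h3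
      linarith
    exact real_inner_self_nonpos.1 h2
  -- (5) transport along the Floquet orbit to every `t < 0`
  have hωall : ∀ t < 0, ∀ x, curl (u t) x = 0 := by
    intro t ht x
    obtain ⟨n, t', ht', hcase⟩ := exists_window_repr hτ (-3 * τ) t
    have ht'W : t' ∈ Icc (-3 * τ) (-3 * τ + 2 * τ) := ⟨ht'.1, by linarith [ht'.2]⟩
    have hz : curl (u t') x = 0 := hωW t' ht'W x
    rcases hcase with h | h
    · have h1 := floquet_iter (V := fun s y => curl (u s) y) hτ.le hflω n t'
        (by rw [← h]; exact ht) x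
      rw [← h] at h1
      rw [h1, hz, smul_zero]
    · have ht'0 : t' < 0 := by linarith [ht'.2]
      have h1 := floquet_iter (V := fun s y => curl (u s) y) hτ.le hflω n t
        (by rw [← h]; exact ht'0) x
      rw [← h, hz] at h1
      exact (smul_eq_zero.1 h1.symm).resolve_left (pow_ne_zero n hμ0)
  -- (6) the gauge
  exact ModeRank.eq_zero_of_curl_slice_const hu fun t ht => ⟨0, fun x => hωall t ht x⟩

/-- **Row A1fm holds** (files-only; the cell is EXCLUDED IN KERNEL). -/
theorem row_A1fm_holds : Row_A1fm := by
  intro C u hu τ μ hτ hfl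
  by_cases hμ : |μ| ≤ 1
  · exact floquet_contractive hu hτ hfl hμ
  · exact floquet_expansive hu hτ hfl (not_le.1 hμ)

end Summit.NavierStokesRegularity.NavierStokesRegularity.Theorems.ScenarioCensus.FloquetMeter

end
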